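import Summits.ResolutionOfSingularities.ResolutionOfSingularities.Theorems.SplitTowerAlg
import Summits.ResolutionOfSingularities.ResolutionOfSingularities.Theorems.NearExitFibre

/-!
# SplitTower (T2/·) — the type `NotPow` and THE THREE FIBRE KERNELS over a field

Node «SplitTower» of `decomp-res-lens-2` (g34), see `Theorems/MaxContactCutSplitTower.lean`.

The reduced binary form of a split cone at a point of the curve is `B̄ = Σ_{i ≤ n} ḡᵢ T₀^{n−i} T₁^i ∈ κ[T₀, T₁]` with
`ḡ₀ = 1`. The whole fibre analysis of the blow-up of the curve rests on ONE property of the coefficient string: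

* `NotPow κ n ḡ`: in no field extension is `ḡᵢ = C(n, i)·γⁱ` for all `i ≤ n` — i.e. `B̄` is not an `n`-th power
  `(T₀ + γT₁)ⁿ` of a linear form, over any extension. It holds at a point with a middle unit coefficient `ḡ_{i₀} ≠ 0`
  and `C(n, i₀) = 0 ∈ κ` (`notPow_of_choose_eq_zero`), is inherited by field extensions (`NotPow.map`), and at the
  generic point of the curve it is produced by T4 (`SplitTowerEta`).

THE THREE FIBRE KERNELS (`𝔫` a maximal ideal of a polynomial ring `κ[T]` over the field `κ`, `n ≥ 1`):
* `kernel_W`: `Σ ḡᵢ T_a^{n−i} T_bⁱ ∈ 𝔫ⁿ ⇒ T_a, T_b ∈ 𝔫` (the `W`-chart: only the origin of the fibre line);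
* `kernel_U`: `Σ ḡᵢ T_a^{n−i} ∈ 𝔫ⁿ` is impossible (the `U`-chart);
* `kernel_Z`: `Σ ḡᵢ T_bⁱ ∈ 𝔫ⁿ` is impossible (the `z`-chart).
Proof (all three): substitute `T_moving ↦ X + ā`, every other variable by its residue in `K' = κ[T]/𝔫`; the
substitution `θ : κ[T] → K'[X]` maps `𝔫` into `(X)`, so `Xⁿ ∣ θ(B̄) = P(X + ā)` for a polynomial `P` of degree
`≤ n` carrying the `ḡᵢ` as coefficients, and the univariate kernel `coeff_eq_of_comp_X_add_C` (T1) makes the `ḡᵢ`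
binomial multiples of powers of one element of `K'` — excluded by `NotPow` — unless (W-chart) `T_a, T_b ∈ 𝔫`.
The prime versions `kernel_W_prime`, `kernel_U_prime`, `kernel_Z_prime` (`s ∉ 𝔔`, `s·B̄ ∈ 𝔔ⁿ`) follow by
Jacobson avoidance (`NearExit.exists_isMaximal_avoid`) and `NearExit.mem_pow_of_mul_mem_pow`.

Sources: [Hironaka1964] Ch. III §3; [CossartJannsenSaito2020] Ch. 2, Ch. 8; [Matsumura1987] §5.
-/

open IsLocalRing

namespace Summit.ResolutionOfSingularities.ResolutionOfSingularities.Theorems.SplitTower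

/-! ## §N  The type `NotPow` -/

section NotPow

/-- **`NotPow κ n ḡ`**: over no field extension `K ⊇ κ` is the coefficient string `ḡ` of the binomial shape
`ḡᵢ = C(n, i)·γⁱ (i ≤ n)` — the reduced binary form `Σ ḡᵢ T₀^{n−i}T₁ⁱ` is not the `n`-th power of a linear form.
[this node] -/
def NotPow (κ : Type) [Field κ] (n : ℕ) (g : ℕ → κ) : Prop :=
  ∀ (K : Type) [Field K] (f : κ →+* K) (γ : K), ¬ ∀ i ≤ n, f (g i) = (n.choose i : K) * γ ^ i

/-- A non-zero coefficient at an index whose binomial coefficient vanishes in `κ` gives `NotPow`. [this node] -/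
theorem notPow_of_choose_eq_zero {κ : Type} [Field κ] {n : ℕ} {g : ℕ → κ} {i₀ : ℕ} (hi₀ : i₀ ≤ n)
    (hg : g i₀ ≠ 0) (hc : ((n.choose i₀ : ℕ) : κ) = 0) : NotPow κ n g := by
  intro K _ f γ hf
  have h := hf i₀ hi₀
  rw [show ((n.choose i₀ : ℕ) : K) = f (n.choose i₀ : κ) by rw [map_natCast], hc, map_zero, zero_mul,
    map_eq_zero_iff f f.injective] at h
  exact hg h

end NotPow

/-! ## §S  The substitution `θ` and coefficient bookkeeping -/

section Subst

open Polynomial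

/-- If a ring map `θ : R → K'[X]` has constant coefficients given by `π` and `π` kills `𝔫`, then `θ` maps `𝔫ⁿ` into
`(Xⁿ)`. [folklore] -/
theorem X_pow_dvd_of_mem_pow {R K' : Type} [CommRing R] [CommRing K'] (θ : R →+* K'[X]) (π : R →+* K')
    (hθ : ∀ q, (θ q).coeff 0 = π q) {𝔫 : Ideal R} (h𝔫 : ∀ q ∈ 𝔫, π q = 0) {n : ℕ} {q : R}
    (hq : q ∈ 𝔫 ^ n) : X ^ n ∣ θ q := by
  have hle : 𝔫 ≤ (Ideal.span {(X : K'[X])}).comap θ := fun q' hq' => by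
    rw [Ideal.mem_comap, Ideal.mem_span_singleton, X_dvd_iff, hθ]
    exact h𝔫 q' hq'
  have := (Ideal.pow_right_mono hle n).trans (Ideal.le_comap_pow θ n) hq
  rwa [Ideal.mem_comap, Ideal.span_singleton_pow, Ideal.mem_span_singleton] at this

/-- Coefficients of `Σ_{i ≤ n} qᵢ X^{n−i}`. [folklore] -/
theorem coeff_sum_rev {K : Type} [CommRing K] (n : ℕ) (q : ℕ → K) {l : ℕ} (hl : l ≤ n) :
    (∑ i ∈ Finset.range (n + 1), C (q i) * X ^ (n - i)).coeff (n - l) = q l := by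
  rw [finsetSum_coeff, Finset.sum_eq_single l]
  · rw [coeff_C_mul_X_pow, if_pos rfl]
  · intro i hi hne
    rw [coeff_C_mul_X_pow, if_neg]
    have := Finset.mem_range.1 hi
    omega
  · intro h; exact absurd (Finset.mem_range.2 (Nat.lt_succ_of_le hl)) h

/-- Coefficients of `Σ_{i ≤ n} qᵢ Xⁱ`. [folklore] -/
theorem coeff_sum_fwd {K : Type} [CommRing K] (n : ℕ) (q : ℕ → K) {l : ℕ} (hl : l ≤ n) :
    (∑ i ∈ Finset.range (n + 1), C (q i) * X ^ i).coeff l = q l := by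
  rw [finsetSum_coeff, Finset.sum_eq_single l]
  · rw [coeff_C_mul_X_pow, if_pos rfl]
  · intro i _ hne
    rw [coeff_C_mul_X_pow, if_neg (Ne.symm hne)]
  · intro h; exact absurd (Finset.mem_range.2 (Nat.lt_succ_of_le hl)) h

/-- `deg Σ_{i ≤ n} qᵢ X^{n−i} ≤ n`. [folklore] -/
theorem natDegree_sum_rev_le {K : Type} [CommRing K] (n : ℕ) (q : ℕ → K) :
    (∑ i ∈ Finset.range (n + 1), C (q i) * X ^ (n - i)).natDegree ≤ n :=
  natDegree_sum_le_of_forall_le _ _ fun i _ => (natDegree_C_mul_X_pow_le _ _).trans (Nat.sub_le n i)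

/-- `deg Σ_{i ≤ n} qᵢ Xⁱ ≤ n`. [folklore] -/
theorem natDegree_sum_fwd_le {K : Type} [CommRing K] (n : ℕ) (q : ℕ → K) :
    (∑ i ∈ Finset.range (n + 1), C (q i) * X ^ i).natDegree ≤ n :=
  natDegree_sum_le_of_forall_le _ _ fun _ hi =>
    (natDegree_C_mul_X_pow_le _ _).trans (Nat.lt_succ_iff.1 (Finset.mem_range.1 hi))

end Subst

/-! ## §K  THE THREE FIBRE KERNELS at a maximal ideal -/

section Kernels

open MvPolynomial

variable {κ : Type} [Field κ] {σ : Type} [DecidableEq σ]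

/-- The substitution `θ_{a, 𝔫} : κ[T] → (κ[T]/𝔫)[X]`: `T_a ↦ X + T̄_a`, `T_l ↦ T̄_l (l ≠ a)`, constants reduced.
[this node] -/
noncomputable def subst (𝔫 : Ideal (MvPolynomial σ κ)) (a : σ) :
    MvPolynomial σ κ →+* Polynomial (MvPolynomial σ κ ⧸ 𝔫) :=
  eval₂Hom (Polynomial.C.comp ((Ideal.Quotient.mk 𝔫).comp C))
    (fun l => if l = a then Polynomial.X + Polynomial.C (Ideal.Quotient.mk 𝔫 (X a))
      else Polynomial.C (Ideal.Quotient.mk 𝔫 (X l)))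

/-- `θ` on constants. [this node] -/
theorem subst_C (𝔫 : Ideal (MvPolynomial σ κ)) (a : σ) (r : κ) :
    subst 𝔫 a (C r) = Polynomial.C (Ideal.Quotient.mk 𝔫 (C r)) := by
  simp [subst]

/-- `θ` on the moving variable. [this node] -/
theorem subst_X_self (𝔫 : Ideal (MvPolynomial σ κ)) (a : σ) :
    subst 𝔫 a (X a) = Polynomial.X + Polynomial.C (Ideal.Quotient.mk 𝔫 (X a)) := by
  simp [subst]

/-- `θ` on the other variables. [this node] -/
theorem subst_X_ne (𝔫 : Ideal (MvPolynomial σ κ)) {a l : σ} (h : l ≠ a) :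
    subst 𝔫 a (X l) = Polynomial.C (Ideal.Quotient.mk 𝔫 (X l)) := by
  simp [subst, h]

/-- The constant coefficient of `θ(q)` is `q mod 𝔫`. [this node] -/
theorem subst_coeff_zero (𝔫 : Ideal (MvPolynomial σ κ)) (a : σ) (q : MvPolynomial σ κ) :
    (subst 𝔫 a q).coeff 0 = Ideal.Quotient.mk 𝔫 q := by
  suffices h : Polynomial.constantCoeff.comp (subst 𝔫 a) = Ideal.Quotient.mk 𝔫 by
    have := congrArg (fun φ => φ q) h
    simpa using this
  refine ringHom_ext (fun r => ?_) (fun l => ?_)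
  · simp [subst_C]
  · by_cases h : l = a
    · subst h; simp [subst_X_self]
    · simp [subst_X_ne 𝔫 h]

/-- `θ` maps `𝔫ⁿ` into `(Xⁿ)`. [this node] -/
theorem X_pow_dvd_subst (𝔫 : Ideal (MvPolynomial σ κ)) (a : σ) {n : ℕ} {q : MvPolynomial σ κ}
    (hq : q ∈ 𝔫 ^ n) : Polynomial.X ^ n ∣ subst 𝔫 a q :=
  X_pow_dvd_of_mem_pow (subst 𝔫 a) (Ideal.Quotient.mk 𝔫) (subst_coeff_zero 𝔫 a)
    (fun _ hq' => Ideal.Quotient.eq_zero_iff_mem.2 hq') hq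

/-- **KERNEL W** (the `W`-chart of the blow-up of the curve): for a maximal ideal `𝔫 ⊂ κ[T]`,
`Σ_{i ≤ n} ḡᵢ T_a^{n−i} T_bⁱ ∈ 𝔫ⁿ` with `ḡ₀ = 1` and `NotPow κ n ḡ` forces `T_a, T_b ∈ 𝔫`: substituting
`T_a ↦ X + ā`, `T_b ↦ b̄` gives `Xⁿ ∣ P(X + ā)` for `P = Σ ḡᵢ b̄ⁱ X^{n−i}`, so `ḡᵢ b̄ⁱ = C(n, i)(−ā)ⁱ` for all `i`
(univariate kernel); if `b̄ ≠ 0` this contradicts `NotPow` with `γ = −ā/b̄`, and if `b̄ = 0` then `āⁿ = 0`.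
[cite: Hironaka1964, Ch. III §3; CossartJannsenSaito2020, Ch. 8] -/
theorem kernel_W {n : ℕ} (hn : 1 ≤ n) {g : ℕ → κ} (hg0 : g 0 = 1) (hg : NotPow κ n g) {a b : σ}
    (hab : a ≠ b) {𝔫 : Ideal (MvPolynomial σ κ)} (h𝔫 : 𝔫.IsMaximal)
    (hB : (∑ i ∈ Finset.range (n + 1), C (g i) * X a ^ (n - i) * X b ^ i) ∈ 𝔫 ^ n) :
    (X a : MvPolynomial σ κ) ∈ 𝔫 ∧ X b ∈ 𝔫 := by
  classical
  letI := Ideal.Quotient.field 𝔫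
  set π := Ideal.Quotient.mk 𝔫 with hπ
  set f : κ →+* MvPolynomial σ κ ⧸ 𝔫 := π.comp C with hf
  set α := π (X a) with hα
  set β := π (X b) with hβ
  set P : Polynomial (MvPolynomial σ κ ⧸ 𝔫) :=
    ∑ i ∈ Finset.range (n + 1), Polynomial.C (f (g i) * β ^ i) * Polynomial.X ^ (n - i) with hP
  have hθB : subst 𝔫 a (∑ i ∈ Finset.range (n + 1), C (g i) * X a ^ (n - i) * X b ^ i) =
      P.comp (Polynomial.X + Polynomial.C α) := by
    rw [map_sum, hP, Polynomial.sum_comp]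
    refine Finset.sum_congr rfl fun i _ => ?_
    rw [map_mul, map_mul, map_pow, map_pow, subst_C, subst_X_self, subst_X_ne 𝔫 hab.symm,
      Polynomial.mul_comp, Polynomial.C_comp, Polynomial.X_pow_comp]
    simp only [hf, RingHom.comp_apply, map_mul, map_pow]
    ring
  have hcoef : ∀ i < n, (P.comp (Polynomial.X + Polynomial.C α)).coeff i = 0 :=
    Polynomial.X_pow_dvd_iff.1 (by rw [← hθB]; exact X_pow_dvd_subst 𝔫 a hB)
  have hU := coeff_eq_of_comp_X_add_C (natDegree_sum_rev_le n _) α hcoef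
  rw [← hP] at hU
  set c := (P.comp (Polynomial.X + Polynomial.C α)).coeff n with hc
  have hc1 : c = 1 := by
    have h0 := coeff_sum_rev n (fun i => f (g i) * β ^ i) (Nat.zero_le n)
    rw [← hP, Nat.sub_zero, hU n, hg0, map_one, pow_zero, mul_one, Nat.sub_self, pow_zero, Nat.choose_self,
      Nat.cast_one, mul_one, mul_one] at h0
    exact h0
  have hmain : ∀ l ≤ n, f (g l) * β ^ l = ((n.choose l : ℕ) : MvPolynomial σ κ ⧸ 𝔫) * (-α) ^ l := by
    intro l hl
    have h := coeff_sum_rev n (fun i => f (g i) * β ^ i) hl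
    rw [← hP, hU (n - l), hc1, one_mul, Nat.sub_sub_self hl, Nat.choose_symm hl] at h
    rw [← h, mul_comm]
  by_cases hβ0 : β = 0
  · have h := hmain n le_rfl
    rw [hβ0, zero_pow (by omega), mul_zero, Nat.choose_self, Nat.cast_one, one_mul] at h
    have hα0 : α = 0 := neg_eq_zero.1 ((pow_eq_zero_iff (by omega)).1 h.symm)
    exact ⟨Ideal.Quotient.eq_zero_iff_mem.1 hα0, Ideal.Quotient.eq_zero_iff_mem.1 hβ0⟩
  · exfalso
    refine hg _ f (-α / β) fun i hi => ?_
    rw [div_pow, ← mul_div_assoc, eq_div_iff (pow_ne_zero i hβ0)]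
    exact hmain i hi

/-- **KERNEL U** (the `U`-chart): `Σ_{i ≤ n} ḡᵢ T_a^{n−i} ∈ 𝔫ⁿ` is impossible (`ḡ₀ = 1`, `NotPow`): substituting
`T_a ↦ X + ā` gives `ḡᵢ = C(n, i)(−ā)ⁱ`. [cite: Hironaka1964, Ch. III §3] -/
theorem kernel_U {n : ℕ} {g : ℕ → κ} (hg0 : g 0 = 1) (hg : NotPow κ n g) (a : σ)
    {𝔫 : Ideal (MvPolynomial σ κ)} (h𝔫 : 𝔫.IsMaximal)
    (hB : (∑ i ∈ Finset.range (n + 1), C (g i) * X a ^ (n - i)) ∈ 𝔫 ^ n) : False := by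
  classical
  letI := Ideal.Quotient.field 𝔫
  set π := Ideal.Quotient.mk 𝔫 with hπ
  set f : κ →+* MvPolynomial σ κ ⧸ 𝔫 := π.comp C with hf
  set α := π (X a) with hα
  set P : Polynomial (MvPolynomial σ κ ⧸ 𝔫) :=
    ∑ i ∈ Finset.range (n + 1), Polynomial.C (f (g i)) * Polynomial.X ^ (n - i) with hP
  have hθB : subst 𝔫 a (∑ i ∈ Finset.range (n + 1), C (g i) * X a ^ (n - i)) =
      P.comp (Polynomial.X + Polynomial.C α) := by
    rw [map_sum, hP, Polynomial.sum_comp]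
    refine Finset.sum_congr rfl fun i _ => ?_
    rw [map_mul, map_pow, subst_C, subst_X_self, Polynomial.mul_comp, Polynomial.C_comp,
      Polynomial.X_pow_comp]
    simp only [hf, hα, hπ, RingHom.comp_apply]
  have hcoef : ∀ i < n, (P.comp (Polynomial.X + Polynomial.C α)).coeff i = 0 :=
    Polynomial.X_pow_dvd_iff.1 (by rw [← hθB]; exact X_pow_dvd_subst 𝔫 a hB)
  have hU := coeff_eq_of_comp_X_add_C (natDegree_sum_rev_le n _) α hcoef
  rw [← hP] at hU
  set c := (P.comp (Polynomial.X + Polynomial.C α)).coeff n with hc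
  have hc1 : c = 1 := by
    have h0 := coeff_sum_rev n (fun i => f (g i)) (Nat.zero_le n)
    rw [← hP, Nat.sub_zero, hU n, hg0, map_one, Nat.sub_self, pow_zero, Nat.choose_self, Nat.cast_one,
      mul_one, mul_one] at h0
    exact h0
  refine hg _ f (-α) fun l hl => ?_
  have h := coeff_sum_rev n (fun i => f (g i)) hl
  rw [← hP, hU (n - l), hc1, one_mul, Nat.sub_sub_self hl, Nat.choose_symm hl] at h
  rw [← h, mul_comm]

/-- **KERNEL Z** (the `z`-chart): `Σ_{i ≤ n} ḡᵢ T_bⁱ ∈ 𝔫ⁿ` is impossible (`ḡ₀ = 1`, `n ≥ 1`, `NotPow`):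
substituting `T_b ↦ X + b̄` gives `ḡᵢ = c·C(n, i)(−b̄)^{n−i}` with `c(−b̄)ⁿ = 1`, i.e. `ḡᵢ = C(n, i)γⁱ` for
`γ = (−b̄)⁻¹`. [cite: Hironaka1964, Ch. III §3] -/
theorem kernel_Z {n : ℕ} (hn : 1 ≤ n) {g : ℕ → κ} (hg0 : g 0 = 1) (hg : NotPow κ n g) (b : σ)
    {𝔫 : Ideal (MvPolynomial σ κ)} (h𝔫 : 𝔫.IsMaximal)
    (hB : (∑ i ∈ Finset.range (n + 1), C (g i) * X b ^ i) ∈ 𝔫 ^ n) : False := by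
  classical
  letI := Ideal.Quotient.field 𝔫
  set π := Ideal.Quotient.mk 𝔫 with hπ
  set f : κ →+* MvPolynomial σ κ ⧸ 𝔫 := π.comp C with hf
  set β := π (X b) with hβ
  set P : Polynomial (MvPolynomial σ κ ⧸ 𝔫) :=
    ∑ i ∈ Finset.range (n + 1), Polynomial.C (f (g i)) * Polynomial.X ^ i with hP
  have hθB : subst 𝔫 b (∑ i ∈ Finset.range (n + 1), C (g i) * X b ^ i) =
      P.comp (Polynomial.X + Polynomial.C β) := by
    rw [map_sum, hP, Polynomial.sum_comp]
    refine Finset.sum_congr rfl fun i _ => ?_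
    rw [map_mul, map_pow, subst_C, subst_X_self, Polynomial.mul_comp, Polynomial.C_comp,
      Polynomial.X_pow_comp]
    simp only [hf, hβ, hπ, RingHom.comp_apply]
  have hcoef : ∀ i < n, (P.comp (Polynomial.X + Polynomial.C β)).coeff i = 0 :=
    Polynomial.X_pow_dvd_iff.1 (by rw [← hθB]; exact X_pow_dvd_subst 𝔫 b hB)
  have hU := coeff_eq_of_comp_X_add_C (natDegree_sum_fwd_le n _) β hcoef
  rw [← hP] at hU
  set c := (P.comp (Polynomial.X + Polynomial.C β)).coeff n with hc
  have hcoefP : ∀ l ≤ n, f (g l) = c * ((-β) ^ (n - l) * ((n.choose l : ℕ) : MvPolynomial σ κ ⧸ 𝔫)) := by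
    intro l hl
    have h := coeff_sum_fwd n (fun i => f (g i)) hl
    rw [← hP, hU l] at h
    exact h.symm
  have h1 : c * (-β) ^ n = 1 := by
    have h := hcoefP 0 (Nat.zero_le n)
    rw [hg0, map_one, Nat.sub_zero, Nat.choose_zero_right, Nat.cast_one, mul_one] at h
    exact h.symm
  have hβ : (-β) ≠ 0 := by
    intro h0
    rw [h0, zero_pow (by omega), mul_zero] at h1
    exact zero_ne_one h1
  have hc' : c = ((-β) ^ n)⁻¹ := eq_inv_of_mul_eq_one_left h1
  refine hg _ f ((-β)⁻¹) fun i hi => ?_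
  have hsplit : (-β) ^ n = (-β) ^ (n - i) * (-β) ^ i := by rw [← pow_add, Nat.sub_add_cancel hi]
  rw [hcoefP i hi, hc', hsplit, mul_inv, inv_pow,
    show ∀ (u v w : MvPolynomial σ κ ⧸ 𝔫), u⁻¹ * v⁻¹ * (u * w) = (u⁻¹ * u) * (v⁻¹ * w) from fun u v w => by ring,
    inv_mul_cancel₀ (pow_ne_zero _ hβ), one_mul, mul_comm]

/-! ### The kernels at a prime -/

variable [Finite σ]

/-- **KERNEL W at a prime**: `𝔔` prime, `s ∉ 𝔔`, `s·Σ ḡᵢ T_a^{n−i} T_bⁱ ∈ 𝔔ⁿ ⇒ T_a, T_b ∈ 𝔔` (Jacobson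
avoidance: test at a maximal `𝔫 ⊇ 𝔔` avoiding `s·T_a`, resp. `s·T_b`). [cite: Matsumura1987, §5] -/
theorem kernel_W_prime {n : ℕ} (hn : 1 ≤ n) {g : ℕ → κ} (hg0 : g 0 = 1) (hg : NotPow κ n g) {a b : σ}
    (hab : a ≠ b) {𝔔 : Ideal (MvPolynomial σ κ)} (h𝔔 : 𝔔.IsPrime) {s : MvPolynomial σ κ} (hs : s ∉ 𝔔)
    (hB : s * (∑ i ∈ Finset.range (n + 1), C (g i) * X a ^ (n - i) * X b ^ i) ∈ 𝔔 ^ n) :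
    (X a : MvPolynomial σ κ) ∈ 𝔔 ∧ X b ∈ 𝔔 := by
  have key : ∀ t : MvPolynomial σ κ, (∀ 𝔫 : Ideal (MvPolynomial σ κ), 𝔫.IsMaximal →
      (∑ i ∈ Finset.range (n + 1), C (g i) * X a ^ (n - i) * X b ^ i) ∈ 𝔫 ^ n → t ∈ 𝔫) → t ∈ 𝔔 := by
    intro t ht
    by_contra htQ
    have hst : s * t ∉ 𝔔 := fun h => (h𝔔.mem_or_mem h).elim hs htQ
    obtain ⟨𝔫, h𝔫, h𝔔𝔫, hst𝔫, -⟩ := NearExit.exists_isMaximal_avoid h𝔔 hst ∅ (by simp)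
    have hs𝔫 : s ∉ 𝔫 := fun h => hst𝔫 (Ideal.mul_mem_right _ _ h)
    have ht𝔫 : t ∉ 𝔫 := fun h => hst𝔫 (Ideal.mul_mem_left _ _ h)
    exact ht𝔫 (ht 𝔫 h𝔫 (NearExit.mem_pow_of_mul_mem_pow h𝔫 hs𝔫 n (Ideal.pow_right_mono h𝔔𝔫 n hB)))
  exact ⟨key _ fun 𝔫 h𝔫 h => (kernel_W hn hg0 hg hab h𝔫 h).1,
    key _ fun 𝔫 h𝔫 h => (kernel_W hn hg0 hg hab h𝔫 h).2⟩

/-- **KERNEL U at a prime**: `𝔔` prime, `s ∉ 𝔔`, `s·Σ ḡᵢ T_a^{n−i} ∈ 𝔔ⁿ` is impossible.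
[cite: Matsumura1987, §5] -/
theorem kernel_U_prime {n : ℕ} {g : ℕ → κ} (hg0 : g 0 = 1) (hg : NotPow κ n g) (a : σ)
    {𝔔 : Ideal (MvPolynomial σ κ)} (h𝔔 : 𝔔.IsPrime) {s : MvPolynomial σ κ} (hs : s ∉ 𝔔)
    (hB : s * (∑ i ∈ Finset.range (n + 1), C (g i) * X a ^ (n - i)) ∈ 𝔔 ^ n) : False := by
  obtain ⟨𝔫, h𝔫, h𝔔𝔫, hs𝔫, -⟩ := NearExit.exists_isMaximal_avoid h𝔔 hs ∅ (by simp)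
  exact kernel_U hg0 hg a h𝔫 (NearExit.mem_pow_of_mul_mem_pow h𝔫 hs𝔫 n (Ideal.pow_right_mono h𝔔𝔫 n hB))

/-- **KERNEL Z at a prime**: `𝔔` prime, `s ∉ 𝔔`, `s·Σ ḡᵢ T_bⁱ ∈ 𝔔ⁿ` is impossible. [cite: Matsumura1987, §5] -/
theorem kernel_Z_prime {n : ℕ} (hn : 1 ≤ n) {g : ℕ → κ} (hg0 : g 0 = 1) (hg : NotPow κ n g) (b : σ)
    {𝔔 : Ideal (MvPolynomial σ κ)} (h𝔔 : 𝔔.IsPrime) {s : MvPolynomial σ κ} (hs : s ∉ 𝔔)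
    (hB : s * (∑ i ∈ Finset.range (n + 1), C (g i) * X b ^ i) ∈ 𝔔 ^ n) : False := by
  obtain ⟨𝔫, h𝔫, h𝔔𝔫, hs𝔫, -⟩ := NearExit.exists_isMaximal_avoid h𝔔 hs ∅ (by simp)
  exact kernel_Z hn hg0 hg b h𝔫 (NearExit.mem_pow_of_mul_mem_pow h𝔫 hs𝔫 n (Ideal.pow_right_mono h𝔔𝔫 n hB))

end Kernels

end Summit.ResolutionOfSingularities.ResolutionOfSingularities.Theorems.SplitTower
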